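import Summits.CriticalPhenomena.Ising3DConformalLimit.Theorems.MoebiusLimitExists.Negative.ScaleRedundant
import Summits.CriticalPhenomena.Ising3DConformalLimit.Theorems.MoebiusLimitExists.Negative.FreeTranslations
import Literature.Probability.LatticeModels.CriticalUrsellFourSign
import Literature.Probability.LatticeModels.GriffithsMonotonicity
import Literature.Probability.LatticeModels.GKSInequalities

/-!
# `MoebiusLimit` (item stmt-CriticalPhenomena-1344): the inversion clause only bites on the even `n ≥ 4` correlators

Structural knowledge about the crux `…Theses.EnergyNotSigmaSquared.MoebiusLimit`
(= `PerfectScreening.MoebiusLimitExists`), standing crux disprover (D-0016); THEOREM-ONLY.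

* `limit_four_ge_two_mul_two`, `limit_four_pos` — GKS II passes to ANY pointwise limit:
  `S₄(x) ≥ S₂(x₀,x₁)S₂(x₂,x₃) > 0` on non-coincident `x` (non-degenerate case).
* `inversion_two_of_covariantLimit` — for an `O(3)`-invariant, scale-covariant (dimension `Δ`),
  non-degenerate pointwise limit of the critical correlators on `ℤ³`, inversion covariance of the
  TWO-point function with the same `Δ` is AUTOMATIC (`S₂(p,q) = A‖p−q‖^{−2Δ}` by free translations +
  `two_point_radial`, and `‖ιp − ιq‖ = ‖p − q‖/(‖p‖‖q‖)`).
* `delta_eq_of_inversion_four` — inversion covariance of `S₄` with `Δ` forces `Δ =` the scale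
  dimension (dilate the axis quadruple `(e,2e,3e,4e)` by `2`; `S₄ > 0` there by GKS II).
* `moebiusLimit_iff_rotation_inversion_ge_four` — hence **the crux is equivalent to**: a
  non-degenerate pointwise limit, `O(3)` invariant, whose correlators of EVEN order `n ≥ 4` are
  inversion covariant for some `Δ`. Everything else (translations, dilations, `0 < Δ`, `n ≤ 3`,
  odd `n`) is automatic: the conformal content proper is the cross-ratio structure of `S₄, S₆, …`.
-/

noncomputable section

namespace Summit.CriticalPhenomena.Ising3DConformalLimit.MoebiusLimitExistsNegative

open Literature.Probability.LatticeModels Literature.Barriers.CriticalPhenomena.ScaleNotMoebius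
open Filter Set EuclideanGeometry
open scoped Topology

variable {ρ : ℝ → ℝ} {Δ : ℝ} {S : CorrFamily 3}

/-! ### GKS II in infinite volume and in the limit -/

/-- GKS II at `β_c` with multiplicities: `⟨σ_{y₀}σ_{y₁}⟩⟨σ_{y₂}σ_{y₃}⟩ ≤ ⟨σ_{y₀}σ_{y₁}σ_{y₂}σ_{y₃}⟩`
(tree `plusCorr_mul_le`, Friedli–Velenik Thm. 3.20 (3.22) in the limit).
[cite: FriedliVelenik2017, Thm. 3.20, eq. (3.22), p. 109] -/
theorem criticalCorr_four_ge (y : Fin 4 → Site 3) :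
    criticalCorr 3 2 ![y 0, y 1] * criticalCorr 3 2 ![y 2, y 3] ≤ criticalCorr 3 4 y := by
  classical
  obtain ⟨A, hA⟩ := exists_spinMonomial_eq_spinProduct ![y 0, y 1]
  obtain ⟨B, hB⟩ := exists_spinMonomial_eq_spinProduct ![y 2, y 3]
  have hy : spinMonomial y = spinProduct (symmDiff A B) := by
    funext s
    have h1 : spinMonomial y s = spinMonomial ![y 0, y 1] s * spinMonomial ![y 2, y 3] s := by
      simp only [spinMonomial, Fin.prod_univ_four, Fin.prod_univ_two, Matrix.cons_val_zero,
        Matrix.cons_val_one]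
      ring
    rw [h1, hA, hB, spinProduct_mul_spinProduct]
  show plusExpect 3 (criticalBeta 3) 0 (spinMonomial ![y 0, y 1]) *
      plusExpect 3 (criticalBeta 3) 0 (spinMonomial ![y 2, y 3]) ≤
    plusExpect 3 (criticalBeta 3) 0 (spinMonomial y)
  rw [hA, hB, hy]
  exact plusCorr_mul_le (criticalBeta_nonneg 3) le_rfl A B

/-- **GKS II passes to any pointwise limit**: `S₂(x₀,x₁) S₂(x₂,x₃) ≤ S₄(x)` on non-coincident `x`.
[cite: FriedliVelenik2017, Thm. 3.20, eq. (3.22), p. 109] -/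
theorem limit_four_ge_two_mul_two (hlim : HasPointwiseScalingLimit (criticalCorr 3) ρ S)
    {x : Fin 4 → EuclideanSpace ℝ (Fin 3)} (hx : x ∈ NonCoincident 3 4) :
    S 2 ![x 0, x 1] * S 2 ![x 2, x 3] ≤ S 4 x := by
  have hinj : Function.Injective x := hx
  have h01 : (![x 0, x 1] : Fin 2 → EuclideanSpace ℝ (Fin 3)) ∈ NonCoincident 3 2 :=
    pair_mem_nonCoincident (hinj.ne (by decide))
  have h23 : (![x 2, x 3] : Fin 2 → EuclideanSpace ℝ (Fin 3)) ∈ NonCoincident 3 2 :=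
    pair_mem_nonCoincident (hinj.ne (by decide))
  refine le_of_tendsto_of_tendsto (((hlim 2).tendsto_at h01).mul ((hlim 2).tendsto_at h23))
    ((hlim 4).tendsto_at hx) (Filter.Eventually.of_forall fun δ => ?_)
  simp only [rescaledCorrelator_apply]
  have key := criticalCorr_four_ge (fun i => latticeApprox δ (x i))
  have e01 : (fun i => latticeApprox δ ((![x 0, x 1] : Fin 2 → EuclideanSpace ℝ (Fin 3)) i)) =
      ![latticeApprox δ (x 0), latticeApprox δ (x 1)] := by
    funext i; fin_cases i <;> rfl
  have e23 : (fun i => latticeApprox δ ((![x 2, x 3] : Fin 2 → EuclideanSpace ℝ (Fin 3)) i)) =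
      ![latticeApprox δ (x 2), latticeApprox δ (x 3)] := by
    funext i; fin_cases i <;> rfl
  rw [e01, e23]
  have h4 : 0 ≤ ρ δ ^ 4 := by positivity
  calc ρ δ ^ 2 * criticalCorr 3 2 ![latticeApprox δ (x 0), latticeApprox δ (x 1)] *
        (ρ δ ^ 2 * criticalCorr 3 2 ![latticeApprox δ (x 2), latticeApprox δ (x 3)])
      = ρ δ ^ 4 * (criticalCorr 3 2 ![latticeApprox δ (x 0), latticeApprox δ (x 1)] *
          criticalCorr 3 2 ![latticeApprox δ (x 2), latticeApprox δ (x 3)]) := by ring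
    _ ≤ ρ δ ^ 4 * criticalCorr 3 4 (fun i => latticeApprox δ (x i)) :=
        mul_le_mul_of_nonneg_left key h4

/-- **`S₄ > 0` on non-coincident configurations** for any non-degenerate pointwise limit.
[cite: FriedliVelenik2017, Thm. 3.20, eq. (3.22), p. 109] -/
theorem limit_four_pos (hlim : HasPointwiseScalingLimit (criticalCorr 3) ρ S)
    (hnd : IsNondegenerateTwoPoint S) {x : Fin 4 → EuclideanSpace ℝ (Fin 3)}
    (hx : x ∈ NonCoincident 3 4) : 0 < S 4 x := by
  have hinj : Function.Injective x := hx
  have h01 := hnd _ (pair_mem_nonCoincident (hinj.ne (by decide : (0 : Fin 4) ≠ 1)))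
  have h23 := hnd _ (pair_mem_nonCoincident (hinj.ne (by decide : (2 : Fin 4) ≠ 3)))
  exact lt_of_lt_of_le (mul_pos h01 h23) (limit_four_ge_two_mul_two hlim hx)

/-! ### Inversion covariance of the two-point function is automatic -/

/-- A two-point configuration equals `![x 0, x 1]`. [folklore] -/
theorem eq_vec_two (x : Fin 2 → EuclideanSpace ℝ (Fin 3)) : x = ![x 0, x 1] := by
  funext i; fin_cases i <;> rfl

/-- **Inversion covariance of `S₂` is automatic** for an `O(3)`-invariant, scale-covariant
non-degenerate pointwise limit (on non-coincident pairs avoiding the origin).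
[cite: FrancescoMathieuSenechal1997, §4.3.1 eq. (4.55)] -/
theorem inversion_two_of_covariantLimit (hlim : HasPointwiseScalingLimit (criticalCorr 3) ρ S)
    (hrot : IsRotationInvariant S) (hsc : IsScaleCovariant Δ S)
    (x : Fin 2 → EuclideanSpace ℝ (Fin 3)) (hx0 : ∀ i, x i ≠ 0) (hx : x ∈ NonCoincident 3 2) :
    S 2 (fun i => inversion 0 1 (x i)) = (∏ i, ‖x i‖ ^ (2 * Δ)) * S 2 x := by
  have hinj : Function.Injective x := hx
  have hne : x 0 ≠ x 1 := hinj.ne (by decide)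
  have hιne : inversion (0 : EuclideanSpace ℝ (Fin 3)) 1 (x 0) ≠ inversion 0 1 (x 1) :=
    fun h => hne (inversion_injective _ one_ne_zero h)
  have hsub : x 1 - x 0 ≠ 0 := sub_ne_zero.2 hne.symm
  have hιsub : inversion (0 : EuclideanSpace ℝ (Fin 3)) 1 (x 1) - inversion 0 1 (x 0) ≠ 0 :=
    sub_ne_zero.2 hιne.symm
  -- both sides through the radial two-point function
  have hR : S 2 x = ‖x 1 - x 0‖ ^ (-(2:ℝ) * Δ) * S 2 ![0, EuclideanSpace.single 0 1] := by
    rw [congrArg (S 2) (eq_vec_two x), limit_two_eq_of_sub hlim hne, two_point_radial hrot hsc hsub]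
  have hL : S 2 (fun i => inversion 0 1 (x i)) =
      ‖inversion (0 : EuclideanSpace ℝ (Fin 3)) 1 (x 1) - inversion 0 1 (x 0)‖ ^ (-(2:ℝ) * Δ) *
        S 2 ![0, EuclideanSpace.single 0 1] := by
    have e : (fun i => inversion (0 : EuclideanSpace ℝ (Fin 3)) 1 (x i)) =
        ![inversion 0 1 (x 0), inversion 0 1 (x 1)] := by
      funext i; fin_cases i <;> rfl
    rw [e, limit_two_eq_of_sub hlim hιne, two_point_radial hrot hsc hιsub]
  -- the inversion distorts distances by `1/(‖x₀‖‖x₁‖)`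
  have hdist : ‖inversion (0 : EuclideanSpace ℝ (Fin 3)) 1 (x 1) - inversion 0 1 (x 0)‖ =
      ‖x 1 - x 0‖ / (‖x 1‖ * ‖x 0‖) := by
    rw [← dist_eq_norm, dist_inversion_inversion (hx0 1) (hx0 0), dist_eq_norm, dist_eq_norm,
      dist_eq_norm, sub_zero, sub_zero, one_pow, div_mul_eq_mul_div, one_mul]
  have h0 : 0 < ‖x 0‖ := norm_pos_iff.2 (hx0 0)
  have h1 : 0 < ‖x 1‖ := norm_pos_iff.2 (hx0 1)
  have hd : 0 < ‖x 1 - x 0‖ := norm_pos_iff.2 hsub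
  rw [hL, hR, hdist, Fin.prod_univ_two, Real.div_rpow hd.le (by positivity),
    Real.mul_rpow h1.le h0.le]
  have e1 : ‖x 1‖ ^ (-(2:ℝ) * Δ) = (‖x 1‖ ^ (2 * Δ))⁻¹ := by
    rw [show (-(2:ℝ) * Δ) = -(2 * Δ) by ring, Real.rpow_neg h1.le]
  have e0 : ‖x 0‖ ^ (-(2:ℝ) * Δ) = (‖x 0‖ ^ (2 * Δ))⁻¹ := by
    rw [show (-(2:ℝ) * Δ) = -(2 * Δ) by ring, Real.rpow_neg h0.le]
  rw [e1, e0]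
  have hp0 : 0 < ‖x 0‖ ^ (2 * Δ) := Real.rpow_pos_of_pos h0 _
  have hp1 : 0 < ‖x 1‖ ^ (2 * Δ) := Real.rpow_pos_of_pos h1 _
  field_simp

/-! ### Inversion covariance at `n = 4` pins the dimension -/

/-- Inversion of a dilated axis point: `ι(2·axisPt t) = 2⁻¹·ι(axisPt t)`. [folklore] -/
theorem inversion_two_smul_axisPt {t : ℝ} (ht : t ≠ 0) :
    inversion (0 : EuclideanSpace ℝ (Fin 3)) 1 ((2:ℝ) • axisPt t) = (2:ℝ)⁻¹ • inversion 0 1 (axisPt t) := by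
  have h2t : (2:ℝ) * t ≠ 0 := mul_ne_zero two_ne_zero ht
  rw [show (2:ℝ) • axisPt t = axisPt (2 * t) by rw [axisPt, axisPt, smul_smul],
    inversion_axisPt h2t, inversion_axisPt ht, axisPt, axisPt, smul_smul, mul_inv]

/-- **Inversion covariance of `S₄` (dimension `Δ`) forces `Δ` to be the scale dimension `Δ'`**
(evaluate on the axis quadruple `(e, 2e, 3e, 4e)` and its double; `S₄ > 0` there by GKS II).
[cite: FrancescoMathieuSenechal1997, §4.3.1 eq. (4.62)] -/
theorem delta_eq_of_inversion_four {Δ Δ' : ℝ} (hlim : HasPointwiseScalingLimit (criticalCorr 3) ρ S)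
    (hnd : IsNondegenerateTwoPoint S) (hsc : IsScaleCovariant Δ' S)
    (hinv4 : ∀ x : Fin 4 → EuclideanSpace ℝ (Fin 3), (∀ i, x i ≠ 0) →
      S 4 (fun i => inversion 0 1 (x i)) = (∏ i, ‖x i‖ ^ (2 * Δ)) * S 4 x) :
    Δ = Δ' := by
  -- the axis quadruple and its positivity
  set x₀ : Fin 4 → EuclideanSpace ℝ (Fin 3) := fun i => axisPt ((i:ℕ) + 1 : ℝ) with hx₀
  have hti : ∀ i : Fin 4, ((i:ℕ) + 1 : ℝ) ≠ 0 := fun i => by positivity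
  have hx₀0 : ∀ i, x₀ i ≠ 0 := fun i => axisPt_ne_zero (hti i)
  have hx₀m : x₀ ∈ NonCoincident 3 4 := by
    rw [mem_nonCoincident]
    intro i j hij
    have h := axisPt_injective hij
    have : (i:ℕ) = j := by exact_mod_cast (add_right_cancel h)
    exact Fin.ext this
  have hpos : 0 < S 4 x₀ := limit_four_pos hlim hnd hx₀m
  set P : ℝ := ∏ i, ‖x₀ i‖ ^ (2 * Δ) with hP
  have hPpos : 0 < P := Finset.prod_pos fun i _ => Real.rpow_pos_of_pos (norm_pos_iff.2 (hx₀0 i)) _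
  -- inversion at x₀ and at 2·x₀
  have hI1 := hinv4 x₀ hx₀0
  have h2x0 : ∀ i, (2:ℝ) • x₀ i ≠ 0 := fun i => smul_ne_zero two_ne_zero (hx₀0 i)
  have hI2 := hinv4 (fun i => (2:ℝ) • x₀ i) h2x0
  -- `ι(2x₀) = 2⁻¹ ι(x₀)`, then scale covariance
  have hcfg : (fun i => inversion (0 : EuclideanSpace ℝ (Fin 3)) 1 ((2:ℝ) • x₀ i)) =
      fun i => (2:ℝ)⁻¹ • inversion 0 1 (x₀ i) := by
    funext i; exact inversion_two_smul_axisPt (hti i)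
  rw [hcfg, hsc 4 2⁻¹ (by norm_num), hsc 4 2 two_pos, hI1] at hI2
  -- norms of the doubled points
  have hprod : (∏ i, ‖(2:ℝ) • x₀ i‖ ^ (2 * Δ)) = (2:ℝ) ^ (8 * Δ) * P := by
    have h : ∀ i, ‖(2:ℝ) • x₀ i‖ ^ (2 * Δ) = (2:ℝ) ^ (2 * Δ) * ‖x₀ i‖ ^ (2 * Δ) := by
      intro i
      rw [norm_smul, Real.norm_eq_abs, abs_of_pos two_pos, Real.mul_rpow (by norm_num) (norm_nonneg _)]
    simp_rw [h]
    rw [Finset.prod_mul_distrib, Finset.prod_const, Finset.card_univ, Fintype.card_fin, hP]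
    congr 1
    rw [← Real.rpow_natCast, ← Real.rpow_mul (by norm_num)]
    congr 1
    push_cast
    ring
  rw [hprod] at hI2
  -- compare: `2^{4Δ'} P s = 2^{8Δ} P 2^{-4Δ'} s`
  have h1 : ((2:ℝ)⁻¹) ^ (-((4:ℕ):ℝ) * Δ') = (2:ℝ) ^ (4 * Δ') := by
    rw [Real.inv_rpow (by norm_num), ← Real.rpow_neg (by norm_num)]
    congr 1
    push_cast
    ring
  rw [h1] at hI2
  have hs : 0 < P * S 4 x₀ := mul_pos hPpos hpos
  have key : (2:ℝ) ^ (4 * Δ') = (2:ℝ) ^ (8 * Δ) * (2:ℝ) ^ (-((4:ℕ):ℝ) * Δ') := by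
    have := hI2
    -- `2^{4Δ'} * (P * s) = 2^{8Δ} * P * (2^{-4Δ'} * s)`
    have e : (2:ℝ) ^ (8 * Δ) * P * ((2:ℝ) ^ (-((4:ℕ):ℝ) * Δ') * S 4 x₀) =
        ((2:ℝ) ^ (8 * Δ) * (2:ℝ) ^ (-((4:ℕ):ℝ) * Δ')) * (P * S 4 x₀) := by ring
    rw [e] at this
    exact mul_right_cancel₀ hs.ne' this
  rw [← Real.rpow_add two_pos] at key
  have hle1 := (Real.rpow_le_rpow_left_iff one_lt_two).1 key.le
  have hle2 := (Real.rpow_le_rpow_left_iff one_lt_two).1 key.ge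
  push_cast at hle1 hle2
  linarith

/-- Odd correlators of any pointwise limit vanish on `NonCoincident` (`m*(β_c) = 0`).
[cite: AizenmanDuminilCopinSidoraviciusCMP2015, Thm. 1.2] -/
theorem limit_odd_eq_zero' {ρ : ℝ → ℝ} {S : CorrFamily 3}
    (hlim : HasPointwiseScalingLimit (criticalCorr 3) ρ S) {n : ℕ} (hn : Odd n)
    {x : Fin n → EuclideanSpace ℝ (Fin 3)} (hx : x ∈ NonCoincident 3 n) : S n x = 0 := by
  have h := (hlim n).tendsto_at hx
  have hz : ∀ δ, rescaledCorrelator (criticalCorr 3) ρ n δ x = 0 := fun δ => by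
    rw [rescaledCorrelator_apply, criticalCorr_eq_zero_of_odd (d := 3) le_rfl hn, mul_zero]
  simp_rw [hz] at h
  exact (tendsto_nhds_unique tendsto_const_nhds h).symm

/-! ### The crux with inversion demanded only for even `n ≥ 4` -/

/-- **THE CRUX, SHARPENED**: a non-degenerate pointwise limit of the critical correlators on `ℤ³`,
`O(3)` invariant, whose EVEN correlators of order `n ≥ 4` are inversion covariant for some `Δ` —
this is equivalent to `MoebiusLimit`. (Translations, dilations, `0 < Δ`, the two-point function,
`n = 0` and all odd `n` are automatic.) [folklore] -/
theorem moebiusLimit_iff_rotation_inversion_ge_four :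
    Summit.CriticalPhenomena.Ising3DConformalLimit.Theses.EnergyNotSigmaSquared.MoebiusLimit ↔
      ∃ (ρ : ℝ → ℝ) (Δ : ℝ) (S : CorrFamily 3), (∀ δ ∈ Set.Ioc (0:ℝ) 1, 0 < ρ δ) ∧
        HasPointwiseScalingLimit (criticalCorr 3) ρ S ∧ IsNondegenerateTwoPoint S ∧
          IsRotationInvariant S ∧
            ∀ n : ℕ, 4 ≤ n → Even n → ∀ x : Fin n → EuclideanSpace ℝ (Fin 3), (∀ i, x i ≠ 0) →
              S n (fun i => inversion 0 1 (x i)) = (∏ i, ‖x i‖ ^ (2 * Δ)) * S n x := by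
  classical
  constructor
  · rintro ⟨ρ, Δ, S, h1, -, h3, h4, h5⟩
    exact ⟨ρ, Δ, S, h1, h3, h4, h5.1.2, fun n _ _ x hx0 => h5.2.2 n x hx0⟩
  · rintro ⟨ρ, Δ, S, hρ, hlim, hnd, hrot, hinv⟩
    -- the normalised family and its free structure
    set S' : CorrFamily 3 := fun n x => if x ∈ NonCoincident 3 n then S n x else 0 with hS'
    have hlim' : HasPointwiseScalingLimit (criticalCorr 3) ρ S' := normalised_hasLimit hlim
    have hnd' : IsNondegenerateTwoPoint S' := normalised_nondeg hnd
    have htr' : IsTranslationInvariant S' := isTranslationInvariant_normalised_of_limit hlim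
    have hrot' : IsRotationInvariant S' := normalised_rotation hrot
    obtain ⟨Δ', hwin, hsc'⟩ := exists_scaleCovariant_normalised hρ hlim hnd
    have hιmem : ∀ {n : ℕ} (x : Fin n → EuclideanSpace ℝ (Fin 3)),
        (fun i => inversion (0 : EuclideanSpace ℝ (Fin 3)) 1 (x i)) ∈ NonCoincident 3 n ↔
          x ∈ NonCoincident 3 n := fun x => by
      rw [mem_nonCoincident, mem_nonCoincident]
      exact (inversion_injective _ one_ne_zero).of_comp_iff x
    -- the hypothesis transported to S'
    have hinvS' : ∀ n : ℕ, 4 ≤ n → Even n → ∀ x : Fin n → EuclideanSpace ℝ (Fin 3), (∀ i, x i ≠ 0) →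
        S' n (fun i => inversion 0 1 (x i)) = (∏ i, ‖x i‖ ^ (2 * Δ)) * S' n x := by
      intro n hn he x hx0
      by_cases hx : x ∈ NonCoincident 3 n
      · simp only [hS', if_pos ((hιmem x).2 hx), if_pos hx, hinv n hn he x hx0]
      · simp only [hS', if_neg (mt (hιmem x).1 hx), if_neg hx, mul_zero]
    -- the dimension is pinned by n = 4
    have hΔ : Δ = Δ' :=
      delta_eq_of_inversion_four hlim' hnd' hsc' (hinvS' 4 le_rfl (by decide))
    subst hΔ
    -- inversion covariance of S' in every order
    have hinv' : IsInversionCovariant Δ S' := by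
      intro n x hx0
      by_cases hx : x ∈ NonCoincident 3 n
      swap
      · simp only [hS', if_neg (mt (hιmem x).1 hx), if_neg hx, mul_zero]
      rcases Nat.even_or_odd n with he | ho
      · rcases Nat.lt_or_ge n 4 with hlt | hge
        · interval_cases n
          · -- n = 0: both configurations are the empty one
            have hcfg : (fun i => inversion (0 : EuclideanSpace ℝ (Fin 3)) 1 (x i)) = x := by
              funext i; exact Fin.elim0 i
            rw [hcfg]
            simp
          · exact absurd he (by decide)
          · -- n = 2: automatic
            rw [show S' 2 (fun i => inversion 0 1 (x i)) = S 2 (fun i => inversion 0 1 (x i)) by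
                simp only [hS', if_pos ((hιmem x).2 hx)],
              show S' 2 x = S 2 x by simp only [hS', if_pos hx]]
            have hsc2 : IsScaleCovariant Δ S' := hsc'
            -- use the normalised family's covariance (it agrees with S on these configurations)
            have h := inversion_two_of_covariantLimit hlim' hrot' hsc2 x hx0 hx
            simp only [hS', if_pos ((hιmem x).2 hx), if_pos hx] at h
            exact h
          · exact absurd he (by decide)
        · exact hinvS' n hge he x hx0
      · -- odd n: both sides vanish
        have h1 : S' n (fun i => inversion 0 1 (x i)) = 0 := by
          simp only [hS', if_pos ((hιmem x).2 hx)]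
          exact limit_odd_eq_zero' hlim ho ((hιmem x).2 hx)
        have h2 : S' n x = 0 := by
          simp only [hS', if_pos hx]
          exact limit_odd_eq_zero' hlim ho hx
        rw [h1, h2, mul_zero]
    exact ⟨ρ, Δ, S', hρ, by linarith [hwin.1], hlim', hnd', ⟨htr', hrot'⟩, hsc', hinv'⟩

end Summit.CriticalPhenomena.Ising3DConformalLimit.MoebiusLimitExistsNegative

end
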